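import Literature.AlgebraicGeometry.ModuliOfAbelianVarieties.SiegelEllAdicHeckeMovesDense
import Mathlib.FieldTheory.Finite.Basic
import HarnessLib

/-!
# B3+ of the Hecke link: the `ℓ`-adic Hecke move with an INTEGRAL lattice map `γ ∈ GSp_δ(ℚ)`, `γ ≡ 1 (mod N)`,
# `ℓᴷ γ⁻¹` integral

Layer `Literature/AlgebraicGeometry/ModuliOfAbelianVarieties`, namespace `Literature.AlgebraicGeometry.ModuliOfAbelianVarieties`.
THEOREMS ONLY (no definition, no named fact, no instance, no notation, no `sorry`).  From the dense `δ`-typed `ℓ`-power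
Hecke orbit of level `N` (★ `SiegelModuli.exists_ellAdicCongr_toSpForm_smul_mem`: a real symplectic `P` with `A_P`, `M_P`
in `GL_{2g}(ℤ[1/ℓ])`, both `≡ 1 (mod N)`, and `P • Zx` in a prescribed open set) we extract the data the Hecke-link
sockets consume: the move `θ := (P⁻¹ • ·)` of `𝔥_g` (an open map) is induced by the INTEGRAL rational matrix
`γ := ℓ^κ M_P` (`J(θ Z) = γ_ℝ J(Z) γ_ℝ⁻¹` for every `Z`, ★ `jOfSiegel_smul`, [Lange2023AbelianVarietiesComplex] Lemma 7.1.7),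
where `κ` is a multiple of `φ(N)` so that `ℓ^κ ≡ 1 (mod N)` ([IrelandRosen1990]-Euler; Mathlib `Nat.ModEq.pow_totient`)
and hence `γ ≡ 1 (mod N)` (QA4), `ℓ^{2κ} γ⁻¹ = ℓ^κ A_P` is integral (QA2 with `m = ℓ^{2κ}`), and
`ᵗγ E_δ γ = ℓ^{2κ} E_δ` (QA3: `γ ∈ GSp_δ(ℚ)` with multiplier `ℓ^{2κ} > 0`; `A_{P⁻¹} ∈ Sp(V, E_δ)`, ★ `mem_spForm_iff`).
With principal adelic representatives (`Λ_r = ℤ^{2g}`) these are the clauses of B-p14 (g14)'s `QuotientAdapted δ δ N (N·ℓ^{2κ}) r r′ γ`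
(text v2; cell hodgecm-mathlib, Hecke-link line card v1.1, B-plan1 (g14) 2026-08-29T19:38:16Z (2) «(A3) := ℓ-adic
choice», `ℓ` prime to `N`).  Count-neutral capital: HC_CM is proved only modulo the 7 printed citations until rung 0
closes; this file discharges none of them.

## References
* [PlatonovRapinchuk1994] V. Platonov, A. Rapinchuk, *Algebraic Groups and Number Theory* (1994), §7.4 Thm. 7.12.
* [Lange2023AbelianVarietiesComplex] H. Lange, *Abelian Varieties over the Complex Numbers* (2023), §7.1.2 Lemma 7.1.7.
* [Milne2005ShimuraVarieties] J. S. Milne, *Introduction to Shimura Varieties* (2005), §6 Thm. 6.11 pp. 74–75.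
-/

set_option autoImplicit false

noncomputable section

open Matrix Function Set Filter
open scoped Topology

namespace Literature.AlgebraicGeometry.ModuliOfAbelianVarieties

section Move

open SiegelModuli
open Literature.NumberTheory.Automorphic (siegelUpperHalfSpace)

variable {g : ℕ} {δ : Fin g → ℕ} (ℓ N : ℕ)

/-- **B3+ — THE `ℓ`-ADIC HECKE MOVE OF LEVEL `N` WITH AN INTEGRAL LATTICE MAP `γ ≡ 1 (mod N)`.**  For `ℓ ≥ 2` prime to
`N ≥ 1`, a polarisation type `δ` (`δᵢ ≥ 1`), a period `Zx ∈ 𝔥_g` and a non-empty open `V ⊆ 𝔥_g` there are a real symplectic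
`P` with `P • Zx ∈ V`, an INTEGRAL `γ ∈ GL_{2g}(ℚ)` and `K : ℕ` with: (i) `J(P⁻¹ • Z) = γ_ℝ J(Z) γ_ℝ⁻¹` for EVERY `Z`;
(ii) `γ ≡ 1 (mod N)` entrywise; (iii) `ℓᴷ γ⁻¹` integral; (iv) `ᵗγ E_δ γ = ℓᴷ E_δ` (multiplier `ℓᴷ > 0`).
[cite: PlatonovRapinchuk1994, §7.4 Thm. 7.12] [cite: Lange2023AbelianVarietiesComplex, §7.1.2 Lemma 7.1.7]
[cite: Milne2005ShimuraVarieties, §6 Thm. 6.11 p. 74 and p. 75] -/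
theorem exists_ellAdicMove_integral (hℓ : 2 ≤ ℓ) (hN : 0 < N) (hℓN : Nat.Coprime ℓ N) (hδ : ∀ i, 0 < δ i)
    (Zx : siegelUpperHalfSpace g) {V : Set (siegelUpperHalfSpace g)} (hV : IsOpen V) (hne : V.Nonempty) :
    ∃ (P : Matrix.symplecticGroup (Fin g) ℝ) (γ : GL (Fin g ⊕ Fin g) ℚ) (K : ℕ),
      P • Zx ∈ V ∧
      (∀ Z : siegelUpperHalfSpace g,
        jOfSiegel δ ((P⁻¹ • Z : siegelUpperHalfSpace g) : Matrix (Fin g) (Fin g) ℂ) =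
          conjJ (Matrix.GeneralLinearGroup.map (algebraMap ℚ ℝ) γ)
            (jOfSiegel δ ((Z : siegelUpperHalfSpace g) : Matrix (Fin g) (Fin g) ℂ))) ∧
      (∀ i j, ∃ z : ℤ, (γ : Matrix (Fin g ⊕ Fin g) (Fin g ⊕ Fin g) ℚ) i j = z) ∧
      (∀ i j, ∃ z : ℤ, (γ : Matrix (Fin g ⊕ Fin g) (Fin g ⊕ Fin g) ℚ) i j -
        (1 : Matrix (Fin g ⊕ Fin g) (Fin g ⊕ Fin g) ℚ) i j = N * z) ∧
      (∀ i j, ∃ z : ℤ, (ℓ : ℚ) ^ K * ((γ⁻¹ : GL (Fin g ⊕ Fin g) ℚ) : Matrix (Fin g ⊕ Fin g) (Fin g ⊕ Fin g) ℚ) i j = z) ∧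
      (γ : Matrix (Fin g ⊕ Fin g) (Fin g ⊕ Fin g) ℚ)ᵀ * typeFormOver δ ℚ * (γ : Matrix (Fin g ⊕ Fin g) (Fin g ⊕ Fin g) ℚ) =
        ((ℓ : ℚ) ^ K) • typeFormOver δ ℚ := by
  classical
  obtain ⟨P, hP, hPV⟩ := exists_ellAdicCongr_toSpForm_smul_mem ℓ N hℓ hN hδ Zx hV hne
  -- the move `P⁻¹` and the unit `Mu = A_{P⁻¹} = M_P`, a congruence point of level `N`
  obtain ⟨k, hMk, hAk⟩ := ellAdicCongr_toSpForm_inv ℓ N hδ hP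
  set Mu : GL (Fin g ⊕ Fin g) ℝ := ((toSpForm hδ P⁻¹ : spForm δ) : GL (Fin g ⊕ Fin g) ℝ) with hMudef
  have hℓpos : (0 : ℝ) < ℓ := by exact_mod_cast (by omega : 0 < ℓ)
  -- the exponent `κ = k + e`, `κ = k·φ(N)`, so that `ℓ^κ ≡ 1 (mod N)`
  set e : ℕ := k * (Nat.totient N - 1) with hedef
  set κ : ℕ := k + e with hκdef
  have hκ : κ = k * Nat.totient N := by
    have ht : 1 ≤ Nat.totient N := Nat.totient_pos.mpr hN
    rw [hκdef, hedef]; zify [ht]; ring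
  have hmod : ((N : ℤ)) ∣ (ℓ : ℤ) ^ κ - 1 := by
    have h1 : ℓ ^ κ ≡ 1 [MOD N] := by
      rw [hκ, mul_comm, pow_mul]
      simpa using (Nat.ModEq.pow_totient hℓN).pow k
    have h2 := Nat.modEq_iff_dvd.mp h1.symm
    push_cast at h2
    exact h2
  obtain ⟨q, hq⟩ := hmod
  have hcne : ((ℓ : ℝ) ^ κ) ≠ 0 := pow_ne_zero κ hℓpos.ne'
  -- the integer matrix `ℓ^κ Mu`
  choose zM hzM using hMk
  choose zA hzA using hAk
  let zγ : Fin g ⊕ Fin g → Fin g ⊕ Fin g → ℤ := fun i j ↦ (ℓ : ℤ) ^ e * (N * zM i j) + (ℓ : ℤ) ^ κ * (if i = j then 1 else 0)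
  let Aq : Matrix (Fin g ⊕ Fin g) (Fin g ⊕ Fin g) ℚ := Matrix.of fun i j ↦ (zγ i j : ℚ)
  have hzγ : ∀ i j, (zγ i j : ℝ) = (ℓ : ℝ) ^ κ * (Mu : Matrix (Fin g ⊕ Fin g) (Fin g ⊕ Fin g) ℝ) i j := fun i j ↦ by
    have h := hzM i j
    rw [Matrix.one_apply] at h
    simp only [zγ]
    push_cast
    rw [hκdef, pow_add]
    split_ifs at h ⊢ <;> linear_combination (-(ℓ : ℝ) ^ e) * h
  have hAq_real : Aq.map (algebraMap ℚ ℝ) = ((ℓ : ℝ) ^ κ) • (Mu : Matrix (Fin g ⊕ Fin g) (Fin g ⊕ Fin g) ℝ) := by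
    ext i j
    simp only [Aq, Matrix.map_apply, Matrix.of_apply, Matrix.smul_apply, smul_eq_mul, eq_ratCast, Rat.cast_intCast]
    exact hzγ i j
  have hdet : Aq.det ≠ 0 := by
    intro h0
    have h1 : (Aq.map (algebraMap ℚ ℝ)).det = 0 := by
      rw [← RingHom.mapMatrix_apply, ← RingHom.map_det, h0, map_zero]
    rw [hAq_real, det_smul, Fintype.card_sum, Fintype.card_fin] at h1
    have h2 : (Mu : Matrix (Fin g ⊕ Fin g) (Fin g ⊕ Fin g) ℝ).det ≠ 0 := Mu.isUnit.map Matrix.detMonoidHom |>.ne_zero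
    exact (mul_ne_zero (pow_ne_zero _ hcne) h2) h1
  let γ : GL (Fin g ⊕ Fin g) ℚ := Matrix.GeneralLinearGroup.mkOfDetNeZero Aq hdet
  have hγval : (γ : Matrix (Fin g ⊕ Fin g) (Fin g ⊕ Fin g) ℚ) = Aq := rfl
  have hγℝ_val : ((Matrix.GeneralLinearGroup.map (algebraMap ℚ ℝ) γ : GL (Fin g ⊕ Fin g) ℝ) : Matrix (Fin g ⊕ Fin g) (Fin g ⊕ Fin g) ℝ) =
      ((ℓ : ℝ) ^ κ) • (Mu : Matrix (Fin g ⊕ Fin g) (Fin g ⊕ Fin g) ℝ) := by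
    rw [← hAq_real]
    ext i j
    rw [Matrix.GeneralLinearGroup.map_apply, Matrix.map_apply, hγval]
  have hγℝ_inv : (((Matrix.GeneralLinearGroup.map (algebraMap ℚ ℝ) γ)⁻¹ : GL (Fin g ⊕ Fin g) ℝ) : Matrix (Fin g ⊕ Fin g) (Fin g ⊕ Fin g) ℝ) =
      ((ℓ : ℝ) ^ κ)⁻¹ • ((Mu⁻¹ : GL (Fin g ⊕ Fin g) ℝ) : Matrix (Fin g ⊕ Fin g) (Fin g ⊕ Fin g) ℝ) := by
    rw [Matrix.coe_units_inv, hγℝ_val]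
    refine Matrix.inv_eq_left_inv ?_
    rw [smul_mul_smul_comm, inv_mul_cancel₀ hcne, one_smul, ← Units.val_mul, inv_mul_cancel, Units.val_one]
  refine ⟨P, γ, 2 * κ, hPV, fun Z ↦ ?_, fun i j ↦ ⟨zγ i j, ?_⟩, fun i j ↦ ⟨(ℓ : ℤ) ^ e * zM i j + (if i = j then q else 0), ?_⟩,
    fun i j ↦ ⟨(ℓ : ℤ) ^ e * (N * zA i j) + (ℓ : ℤ) ^ κ * (if i = j then 1 else 0), ?_⟩, ?_⟩
  · -- (i) the move is induced by `γ`
    rw [conjJ_def, hγℝ_val, hγℝ_inv, smul_mul_assoc, Matrix.smul_mul, Matrix.mul_smul, smul_smul,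
      mul_inv_cancel₀ hcne, one_smul, jOfSiegel_smul hδ P⁻¹ Z, hMudef, coe_toSpForm_inv hδ, coe_toSpForm hδ]
  · simp only [hγval, Aq, Matrix.of_apply]
  · -- (ii) `γ ≡ 1 (mod N)`
    simp only [hγval, Aq, Matrix.of_apply, zγ, Matrix.one_apply]
    push_cast
    split_ifs with hij
    · have hq' : ((ℓ : ℚ)) ^ κ - 1 = (N : ℚ) * (q : ℚ) := by exact_mod_cast hq
      linear_combination hq'
    · ring
  · -- (iii) `ℓ^{2κ} γ⁻¹` is integral: read in `ℝ`, `γ_ℝ⁻¹ = ℓ^{-κ} A_P`, `ℓ^k A_P = N zA + ℓ^k 1`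
    apply (algebraMap ℚ ℝ).injective
    have h1 : (algebraMap ℚ ℝ) (((γ⁻¹ : GL (Fin g ⊕ Fin g) ℚ) : Matrix (Fin g ⊕ Fin g) (Fin g ⊕ Fin g) ℚ) i j) =
        (((Matrix.GeneralLinearGroup.map (algebraMap ℚ ℝ) γ)⁻¹ : GL (Fin g ⊕ Fin g) ℝ) : Matrix (Fin g ⊕ Fin g) (Fin g ⊕ Fin g) ℝ) i j := by
      rw [← map_inv, Matrix.GeneralLinearGroup.map_apply]
    have hA := hzA i j
    rw [Matrix.one_apply] at hA
    rw [map_mul, map_pow, map_natCast, h1, hγℝ_inv, Matrix.smul_apply, smul_eq_mul, eq_ratCast, Rat.cast_intCast,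
      two_mul, pow_add, mul_assoc, mul_inv_cancel_left₀ hcne, hκdef, pow_add]
    push_cast at hA ⊢
    split_ifs at hA ⊢ <;> linear_combination ((ℓ : ℝ) ^ e) * hA
  · -- (iv) multiplier `ℓ^{2κ}`
    apply Matrix.map_injective (f := algebraMap ℚ ℝ) (algebraMap ℚ ℝ).injective
    have hMu : (Mu : Matrix (Fin g ⊕ Fin g) (Fin g ⊕ Fin g) ℝ)ᵀ * realTypeForm δ * (Mu : Matrix (Fin g ⊕ Fin g) (Fin g ⊕ Fin g) ℝ) = realTypeForm δ := mem_spForm_iff.1 (toSpForm hδ P⁻¹).2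
    have hR : (((ℓ : ℚ) ^ (2 * κ)) • typeFormOver δ ℚ).map (algebraMap ℚ ℝ) = ((ℓ : ℝ) ^ (2 * κ)) • realTypeForm δ := by
      rw [← typeFormOver_real_eq_realTypeForm, ← typeFormOver_map δ (algebraMap ℚ ℝ)]
      ext i j
      simp only [Matrix.map_apply, Matrix.smul_apply, smul_eq_mul, map_mul, map_pow, map_natCast]
    change ((γ : Matrix (Fin g ⊕ Fin g) (Fin g ⊕ Fin g) ℚ)ᵀ * typeFormOver δ ℚ *
        (γ : Matrix (Fin g ⊕ Fin g) (Fin g ⊕ Fin g) ℚ)).map (algebraMap ℚ ℝ) =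
      (((ℓ : ℚ) ^ (2 * κ)) • typeFormOver δ ℚ).map (algebraMap ℚ ℝ)
    rw [hR, Matrix.map_mul, Matrix.map_mul, Matrix.transpose_map, typeFormOver_map, typeFormOver_real_eq_realTypeForm,
      hγval, hAq_real, transpose_smul, Matrix.smul_mul, Matrix.smul_mul, Matrix.mul_smul, hMu, smul_smul]
    congr 1
    rw [hκdef]
    ring

end Move

end Literature.AlgebraicGeometry.ModuliOfAbelianVarieties

end
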